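import Summits.CriticalPhenomena.PercolationContinuityZ3.Theorems.PercNearOneGluingNoHeavyLowerTailAntipodalR1TwoCutTransfer
import HarnessLib

/-!
# ANTI₁ across a 2-separation, III: the reduction theorem

Support file for `stmt-CriticalPhenomena-4575` (memo `prim-gen-kcluster/KCLUSTER-gen76.md` §2 / §8 (N4);
conjecture ANTI₁ of `KCLUSTER-gen52.md` §3).  No definitions, no named facts, no sorries.  Vocabulary of
`AntipodalR1` (`clus`, `lSet`, `rSet`; gen 62) and parts I–II (`…AntipodalR1TwoCutPaths`,
`…AntipodalR1TwoCutTransfer`, gen 78).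

Recall ANTI₁ for a finite multigraph `ends : ι → Sym2 V` with apex `a` and terminals `b, c`:
`#L ≤ #R(b,c)`, `L = {x : b, c ∈ O_a ∖ K_a, K_a separates b | c}` (`AntipodalR1.lSet`),
`R(b,c) = {x : b ∈ O_a ∖ K_a, c ∈ K_a ∖ O_a}` (`AntipodalR1.rSet`).

**Theorem** (`AntipodalR1.card_lSet_le_card_rSet_of_twoCut`, the 2-CUT REDUCTION).  Let
`G = G₁ ∪ G₂` be glued along `{u, v}` — `Sum.elim ends₁ ends₂ : ι₁ ⊕ ι₂ → Sym2 V` with every vertex met by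
an edge of `G₁` non-interior for `G₂` (`∀ j, w ∈ ends₂ j → w = u ∨ w = v`) — and let `a, b, c` be
non-interior.  If ANTI₁ holds
* for the side `G₁` (`ends₁`),
* for `G₁ + e`, `e` a new edge `uv` (`Sum.elim ends₁ (fun _ : Unit => s(u, v))`), and
* for `G₁ + e_O + e_K` with `e_O` an OPEN and `e_K` a CLOSED new edge `uv`, in the fibre form
  "`#{ω₁ : ω₁ ⊕ id ∈ L} ≤ #{ω₁ : ω₁ ⊕ id ∈ R}`" for the system `Sum.elim ends₁ (fun _ : Bool => s(u, v))`
  whose gadget edge `inr col` carries colour `col` (this is ANTI₁ for the contraction `G₁ / uv`,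
  written without quotient types),
then ANTI₁ holds for `G`.  Nothing is assumed about `G₂` (it may be disconnected or empty; `u = v` is
allowed, which covers blocks hanging at a cut vertex away from the terminals).

Proof.  Write `ω = ω₁ ⊕ ω₂`.  By parts I–II, membership of `ω` in `L(G)` / `R(G)` is controlled by
`ω₁` and the *state* of `ω₂` (are `u, v` open-joined / closed-joined inside `G₂`?): `L(G)`-fibres
embed into the `L`-set of the gadget system with the same state and `R`-sets of the gadget system embed
back into `R(G)`-fibres (`card_fibre_lSet_le_gadget`, `card_gadget_rSet_le_fibre`, and the bare-side
versions).  Summing over `ω₂` (`card_eq_sum_card_fibre`) and pairing `ω₂` with its complement `ω̄₂`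
(whose state is the swapped pair, `mem_clus_flip`) makes the two one-edge states appear with equal
multiplicity, so that the three hypotheses suffice (`fibre_pair_le`).  [this work]

Corollary (paper, memo gen76 §2): a counterexample to ANTI₁ with the fewest edges is 2-connected, has
no parallel edges, no non-terminal vertex of degree 2, and every 2-separator has a terminal strictly
inside both sides.
-/

namespace Summit.CriticalPhenomena.PercolationContinuityZ3.Theorems

namespace AntipodalR1

open Finset Relation

variable {V ι₁ ι₂ : Type*}

section Fibre

variable [Fintype ι₁] [DecidableEq ι₁] [Fintype ι₂] [DecidableEq ι₂]

/-- **Fibre decomposition.**  A finite set of colourings of `ι₁ ⊕ ι₂` is counted fibrewise over the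
colouring of the second summand. [this work] -/
theorem card_eq_sum_card_fibre (S : Finset (ι₁ ⊕ ι₂ → Bool)) :
    S.card = ∑ ω₂ : ι₂ → Bool, (univ.filter fun ω₁ : ι₁ → Bool => Sum.elim ω₁ ω₂ ∈ S).card := by
  classical
  have hS : (S.card : ℕ) = ∑ ω : ι₁ ⊕ ι₂ → Bool, if ω ∈ S then 1 else 0 := by
    rw [Finset.sum_boole, Nat.cast_id, Finset.filter_mem_eq_inter, Finset.univ_inter]
  rw [hS, ← Fintype.sum_equiv (⟨fun p => Sum.elim p.2 p.1,
      fun ω => (fun j => ω (Sum.inr j), fun i => ω (Sum.inl i)),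
      fun p => rfl, fun ω => funext fun e => by cases e <;> rfl⟩ :
        (ι₂ → Bool) × (ι₁ → Bool) ≃ (ι₁ ⊕ ι₂ → Bool))
      (fun p => if Sum.elim p.2 p.1 ∈ S then 1 else 0) _ (fun p => rfl),
    Fintype.sum_prod_type]
  refine Finset.sum_congr rfl fun ω₂ _ => ?_
  rw [Finset.sum_boole, Nat.cast_id]

/-- Two-point fibre decomposition for one extra edge (`ι₂ = Unit`). [this work] -/
theorem card_eq_card_fibre_true_add_false (S : Finset (ι₁ ⊕ Unit → Bool)) :
    S.card = (univ.filter fun ω₁ : ι₁ → Bool => Sum.elim ω₁ (fun _ : Unit => true) ∈ S).card +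
      (univ.filter fun ω₁ : ι₁ → Bool => Sum.elim ω₁ (fun _ : Unit => false) ∈ S).card := by
  classical
  rw [card_eq_sum_card_fibre S, ← Fintype.sum_equiv
      (⟨fun t _ => t, fun g => g (), fun t => rfl, fun g => rfl⟩ : Bool ≃ (Unit → Bool))
      (fun t => (univ.filter fun ω₁ : ι₁ → Bool => Sum.elim ω₁ (fun _ : Unit => t) ∈ S).card) _
      (fun t => rfl), Fintype.sum_bool]

/-- Summing over colourings is invariant under the colour swap `ω₂ ↦ ω̄₂`. [this work] -/
theorem sum_flip_eq (f : (ι₂ → Bool) → ℕ) :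
    ∑ ω₂ : ι₂ → Bool, f (fun j => !ω₂ j) = ∑ ω₂ : ι₂ → Bool, f ω₂ :=
  Fintype.sum_equiv (⟨fun ω j => !ω j, fun ω j => !ω j, fun ω => funext fun j => by simp,
    fun ω => funext fun j => by simp⟩ : (ι₂ → Bool) ≃ (ι₂ → Bool)) _ _ (fun ω => rfl)

/-- Pairing each colouring with its colour swap: a pointwise bound on pairs bounds the sums.
[this work] -/
theorem sum_le_sum_of_pair {A B : (ι₂ → Bool) → ℕ}
    (h : ∀ ω₂, A ω₂ + A (fun j => !ω₂ j) ≤ B ω₂ + B (fun j => !ω₂ j)) :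
    ∑ ω₂ : ι₂ → Bool, A ω₂ ≤ ∑ ω₂ : ι₂ → Bool, B ω₂ := by
  refine Nat.le_of_mul_le_mul_left ?_ Nat.two_pos
  calc 2 * ∑ ω₂ : ι₂ → Bool, A ω₂
      = ∑ ω₂ : ι₂ → Bool, A ω₂ + ∑ ω₂ : ι₂ → Bool, A (fun j => !ω₂ j) := by
        rw [two_mul, sum_flip_eq A]
    _ = ∑ ω₂ : ι₂ → Bool, (A ω₂ + A (fun j => !ω₂ j)) := sum_add_distrib.symm
    _ ≤ ∑ ω₂ : ι₂ → Bool, (B ω₂ + B (fun j => !ω₂ j)) := sum_le_sum fun ω₂ _ => h ω₂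
    _ = ∑ ω₂ : ι₂ → Bool, B ω₂ + ∑ ω₂ : ι₂ → Bool, B (fun j => !ω₂ j) := sum_add_distrib
    _ = 2 * ∑ ω₂ : ι₂ → Bool, B ω₂ := by rw [two_mul, sum_flip_eq B]

end Fibre

section Count

variable {ends₁ : ι₁ → Sym2 V} {ends₂ : ι₂ → Sym2 V} {u v a b c : V}
variable [Fintype ι₁] [DecidableEq ι₁] [Fintype ι₂] [DecidableEq ι₂]

/-- An `L(G)`-fibre embeds into the `L`-fibre of any gadget system with the same state. [this work] -/
theorem card_fibre_lSet_le_gadget {κ : Type*} [Fintype κ] [DecidableEq κ]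
    (hsep : ∀ w i, w ∈ ends₁ i → ∀ j, w ∈ ends₂ j → w = u ∨ w = v)
    (ha : ∀ j, a ∈ ends₂ j → a = u ∨ a = v) (hb : ∀ j, b ∈ ends₂ j → b = u ∨ b = v)
    (hc : ∀ j, c ∈ ends₂ j → c = u ∨ c = v) (ω₂ : ι₂ → Bool) (g : κ → Bool)
    (hst : ∀ col, v ∈ clus ends₂ ω₂ col u ↔ (u = v ∨ ∃ k, g k = col)) :
    (univ.filter fun ω₁ : ι₁ → Bool => Sum.elim ω₁ ω₂ ∈ lSet (Sum.elim ends₁ ends₂) a b c).card ≤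
      (univ.filter fun ω₁ : ι₁ → Bool =>
        Sum.elim ω₁ g ∈ lSet (Sum.elim ends₁ (fun _ : κ => s(u, v))) a b c).card := by
  classical
  refine card_le_card fun ω₁ h => mem_filter.2 ⟨mem_univ _, ?_⟩
  exact mem_lSet_gadget_of_mem_lSet (ω := Sum.elim ω₁ ω₂) (ω' := Sum.elim ω₁ g) hsep ha hb hc
    (fun _ => rfl) hst (mem_filter.1 h).2

/-- The `R`-fibre of a gadget system embeds into the `R(G)`-fibre with the same state. [this work] -/
theorem card_gadget_rSet_le_fibre {κ : Type*} [Fintype κ] [DecidableEq κ]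
    (hsep : ∀ w i, w ∈ ends₁ i → ∀ j, w ∈ ends₂ j → w = u ∨ w = v)
    (ha : ∀ j, a ∈ ends₂ j → a = u ∨ a = v) (hb : ∀ j, b ∈ ends₂ j → b = u ∨ b = v)
    (hc : ∀ j, c ∈ ends₂ j → c = u ∨ c = v) (ω₂ : ι₂ → Bool) (g : κ → Bool)
    (hst : ∀ col, v ∈ clus ends₂ ω₂ col u ↔ (u = v ∨ ∃ k, g k = col)) :
    (univ.filter fun ω₁ : ι₁ → Bool =>
        Sum.elim ω₁ g ∈ rSet (Sum.elim ends₁ (fun _ : κ => s(u, v))) a b c).card ≤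
      (univ.filter fun ω₁ : ι₁ → Bool => Sum.elim ω₁ ω₂ ∈ rSet (Sum.elim ends₁ ends₂) a b c).card := by
  classical
  refine card_le_card fun ω₁ h => mem_filter.2 ⟨mem_univ _, ?_⟩
  exact mem_rSet_of_mem_rSet_gadget (ω := Sum.elim ω₁ ω₂) (ω' := Sum.elim ω₁ g) hsep ha hb hc
    (fun _ => rfl) hst (mem_filter.1 h).2

/-- An `L(G)`-fibre over a colouring of `G₂` joining `u, v` by neither colour embeds into `L(G₁)`.
[this work] -/
theorem card_fibre_lSet_le_inl
    (hsep : ∀ w i, w ∈ ends₁ i → ∀ j, w ∈ ends₂ j → w = u ∨ w = v)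
    (ha : ∀ j, a ∈ ends₂ j → a = u ∨ a = v) (hb : ∀ j, b ∈ ends₂ j → b = u ∨ b = v)
    (hc : ∀ j, c ∈ ends₂ j → c = u ∨ c = v) (ω₂ : ι₂ → Bool)
    (hO : v ∉ clus ends₂ ω₂ true u) (hK : v ∉ clus ends₂ ω₂ false u) :
    (univ.filter fun ω₁ : ι₁ → Bool => Sum.elim ω₁ ω₂ ∈ lSet (Sum.elim ends₁ ends₂) a b c).card ≤
      (lSet ends₁ a b c).card := by
  classical
  refine card_le_card fun ω₁ h => ?_
  exact mem_lSet_inl_of_mem_lSet (ω := Sum.elim ω₁ ω₂) hsep ha hb hc hO hK (mem_filter.1 h).2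

/-- `R(G₁)` embeds into the `R(G)`-fibre over a colouring of `G₂` joining `u, v` by neither colour.
[this work] -/
theorem card_rSet_inl_le_fibre
    (hsep : ∀ w i, w ∈ ends₁ i → ∀ j, w ∈ ends₂ j → w = u ∨ w = v)
    (ha : ∀ j, a ∈ ends₂ j → a = u ∨ a = v) (hb : ∀ j, b ∈ ends₂ j → b = u ∨ b = v)
    (hc : ∀ j, c ∈ ends₂ j → c = u ∨ c = v) (ω₂ : ι₂ → Bool)
    (hO : v ∉ clus ends₂ ω₂ true u) (hK : v ∉ clus ends₂ ω₂ false u) :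
    (rSet ends₁ a b c).card ≤
      (univ.filter fun ω₁ : ι₁ → Bool => Sum.elim ω₁ ω₂ ∈ rSet (Sum.elim ends₁ ends₂) a b c).card := by
  classical
  refine card_le_card fun ω₁ h => mem_filter.2 ⟨mem_univ _, ?_⟩
  exact mem_rSet_of_mem_rSet_inl (ω := Sum.elim ω₁ ω₂) hsep ha hb hc hO hK h

/-- **The paired fibre inequality.**  Under the three ANTI₁ hypotheses (bare side, one new edge, one
open and one closed new edge), for every colouring `ω₂` of `G₂`:
`#L-fibre(ω₂) + #L-fibre(ω̄₂) ≤ #R-fibre(ω₂) + #R-fibre(ω̄₂)`. [this work] -/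
theorem fibre_pair_le
    (hsep : ∀ w i, w ∈ ends₁ i → ∀ j, w ∈ ends₂ j → w = u ∨ w = v)
    (ha : ∀ j, a ∈ ends₂ j → a = u ∨ a = v) (hb : ∀ j, b ∈ ends₂ j → b = u ∨ b = v)
    (hc : ∀ j, c ∈ ends₂ j → c = u ∨ c = v)
    (h0 : (lSet ends₁ a b c).card ≤ (rSet ends₁ a b c).card)
    (h1 : (lSet (Sum.elim ends₁ (fun _ : Unit => s(u, v))) a b c).card ≤
      (rSet (Sum.elim ends₁ (fun _ : Unit => s(u, v))) a b c).card)
    (h2 : (univ.filter fun ω₁ : ι₁ → Bool =>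
        Sum.elim ω₁ id ∈ lSet (Sum.elim ends₁ (fun _ : Bool => s(u, v))) a b c).card ≤
      (univ.filter fun ω₁ : ι₁ → Bool =>
        Sum.elim ω₁ id ∈ rSet (Sum.elim ends₁ (fun _ : Bool => s(u, v))) a b c).card)
    (ω₂ : ι₂ → Bool) :
    (univ.filter fun ω₁ : ι₁ → Bool => Sum.elim ω₁ ω₂ ∈ lSet (Sum.elim ends₁ ends₂) a b c).card +
      (univ.filter fun ω₁ : ι₁ → Bool =>
        Sum.elim ω₁ (fun j => !ω₂ j) ∈ lSet (Sum.elim ends₁ ends₂) a b c).card ≤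
    (univ.filter fun ω₁ : ι₁ → Bool => Sum.elim ω₁ ω₂ ∈ rSet (Sum.elim ends₁ ends₂) a b c).card +
      (univ.filter fun ω₁ : ι₁ → Bool =>
        Sum.elim ω₁ (fun j => !ω₂ j) ∈ rSet (Sum.elim ends₁ ends₂) a b c).card := by
  classical
  -- the state of `ω̄₂` is the swapped state of `ω₂`
  have hflip : ∀ col, v ∈ clus ends₂ (fun j => !ω₂ j) col u ↔ v ∈ clus ends₂ ω₂ (!col) u :=
    fun col => mem_clus_flip ends₂ ω₂ col u v
  by_cases hO : v ∈ clus ends₂ ω₂ true u <;> by_cases hK : v ∈ clus ends₂ ω₂ false u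
  · -- state (joined, joined): both fibres go through the two-edge gadget
    have hst : ∀ col, v ∈ clus ends₂ ω₂ col u ↔ (u = v ∨ ∃ k : Bool, id k = col) :=
      fun col => ⟨fun _ => Or.inr ⟨col, rfl⟩, fun _ => by cases col <;> assumption⟩
    have hst' : ∀ col, v ∈ clus ends₂ (fun j => !ω₂ j) col u ↔ (u = v ∨ ∃ k : Bool, id k = col) :=
      fun col => (hflip col).trans ⟨fun _ => Or.inr ⟨col, rfl⟩, fun _ => by cases col <;> assumption⟩
    exact Nat.add_le_add
      (((card_fibre_lSet_le_gadget hsep ha hb hc ω₂ id hst).trans h2).trans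
        (card_gadget_rSet_le_fibre hsep ha hb hc ω₂ id hst))
      (((card_fibre_lSet_le_gadget hsep ha hb hc _ id hst').trans h2).trans
        (card_gadget_rSet_le_fibre hsep ha hb hc _ id hst'))
  · -- state (open-joined only): `ω₂` ↦ the open one-edge gadget, `ω̄₂` ↦ the closed one
    have huv : u ≠ v := fun h => hK (h ▸ ReflTransGen.refl)
    have hst : ∀ col, v ∈ clus ends₂ ω₂ col u ↔ (u = v ∨ ∃ _ : Unit, true = col) := by
      intro col; cases col
      · exact ⟨fun h => (hK h).elim, fun h => h.elim (fun h => (huv h).elim) fun ⟨_, h⟩ => by simp at h⟩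
      · exact ⟨fun _ => Or.inr ⟨(), rfl⟩, fun _ => hO⟩
    have hst' : ∀ col, v ∈ clus ends₂ (fun j => !ω₂ j) col u ↔ (u = v ∨ ∃ _ : Unit, false = col) := by
      intro col; rw [hflip col]; cases col
      · exact ⟨fun _ => Or.inr ⟨(), rfl⟩, fun _ => hO⟩
      · exact ⟨fun h => (hK h).elim, fun h => h.elim (fun h => (huv h).elim) fun ⟨_, h⟩ => by simp at h⟩
    have hL := Nat.add_le_add (card_fibre_lSet_le_gadget hsep ha hb hc ω₂ (fun _ : Unit => true) hst)
      (card_fibre_lSet_le_gadget hsep ha hb hc _ (fun _ : Unit => false) hst')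
    have hR := Nat.add_le_add (card_gadget_rSet_le_fibre hsep ha hb hc ω₂ (fun _ : Unit => true) hst)
      (card_gadget_rSet_le_fibre hsep ha hb hc _ (fun _ : Unit => false) hst')
    rw [← card_eq_card_fibre_true_add_false] at hL hR
    exact (hL.trans h1).trans hR
  · -- state (closed-joined only): the mirror image of the previous case
    have huv : u ≠ v := fun h => hO (h ▸ ReflTransGen.refl)
    have hst : ∀ col, v ∈ clus ends₂ ω₂ col u ↔ (u = v ∨ ∃ _ : Unit, false = col) := by
      intro col; cases col
      · exact ⟨fun _ => Or.inr ⟨(), rfl⟩, fun _ => hK⟩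
      · exact ⟨fun h => (hO h).elim, fun h => h.elim (fun h => (huv h).elim) fun ⟨_, h⟩ => by simp at h⟩
    have hst' : ∀ col, v ∈ clus ends₂ (fun j => !ω₂ j) col u ↔ (u = v ∨ ∃ _ : Unit, true = col) := by
      intro col; rw [hflip col]; cases col
      · exact ⟨fun h => (hO h).elim, fun h => h.elim (fun h => (huv h).elim) fun ⟨_, h⟩ => by simp at h⟩
      · exact ⟨fun _ => Or.inr ⟨(), rfl⟩, fun _ => hK⟩
    have hL := Nat.add_le_add (card_fibre_lSet_le_gadget hsep ha hb hc _ (fun _ : Unit => true) hst')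
      (card_fibre_lSet_le_gadget hsep ha hb hc ω₂ (fun _ : Unit => false) hst)
    have hR := Nat.add_le_add (card_gadget_rSet_le_fibre hsep ha hb hc _ (fun _ : Unit => true) hst')
      (card_gadget_rSet_le_fibre hsep ha hb hc ω₂ (fun _ : Unit => false) hst)
    rw [← card_eq_card_fibre_true_add_false] at hL hR
    rw [Nat.add_comm] at hL
    refine (hL.trans h1).trans (hR.trans_eq (Nat.add_comm _ _))
  · -- state (neither): both fibres go through the bare side
    have hO' : v ∉ clus ends₂ (fun j => !ω₂ j) true u := fun h => hK ((hflip true).1 h)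
    have hK' : v ∉ clus ends₂ (fun j => !ω₂ j) false u := fun h => hO ((hflip false).1 h)
    exact Nat.add_le_add
      (((card_fibre_lSet_le_inl hsep ha hb hc ω₂ hO hK).trans h0).trans
        (card_rSet_inl_le_fibre hsep ha hb hc ω₂ hO hK))
      (((card_fibre_lSet_le_inl hsep ha hb hc _ hO' hK').trans h0).trans
        (card_rSet_inl_le_fibre hsep ha hb hc _ hO' hK'))

/-- **The 2-cut reduction for ANTI₁** (memo `KCLUSTER-gen76` §2, kernel form).  Let `G = G₁ ∪ G₂` be
two edge systems on a common vertex type glued along `{u, v}`: every vertex met by an edge of `G₁` is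
met by edges of `G₂` only if it is `u` or `v`, and the apex `a` and the terminals `b, c` are met by
edges of `G₂` only if they are `u` or `v`.  Suppose ANTI₁ (`#L ≤ #R(b,c)`) holds for
(0) the side `G₁` alone, (1) `G₁` plus one new edge `uv`, and (2) `G₁` plus an open and a closed new
edge `uv` (fibre form: colourings `ω₁ ⊕ id` of `Sum.elim ends₁ (fun _ : Bool => s(u, v))`, i.e. ANTI₁
for the contraction `G₁ / uv`).  Then ANTI₁ holds for `G`.  No hypothesis on `G₂`. [this work] -/
theorem card_lSet_le_card_rSet_of_twoCut (ends₁ : ι₁ → Sym2 V) (ends₂ : ι₂ → Sym2 V)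
    (u v a b c : V)
    (hsep : ∀ w i, w ∈ ends₁ i → ∀ j, w ∈ ends₂ j → w = u ∨ w = v)
    (ha : ∀ j, a ∈ ends₂ j → a = u ∨ a = v) (hb : ∀ j, b ∈ ends₂ j → b = u ∨ b = v)
    (hc : ∀ j, c ∈ ends₂ j → c = u ∨ c = v)
    (h0 : (lSet ends₁ a b c).card ≤ (rSet ends₁ a b c).card)
    (h1 : (lSet (Sum.elim ends₁ (fun _ : Unit => s(u, v))) a b c).card ≤
      (rSet (Sum.elim ends₁ (fun _ : Unit => s(u, v))) a b c).card)
    (h2 : (univ.filter fun ω₁ : ι₁ → Bool =>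
        Sum.elim ω₁ id ∈ lSet (Sum.elim ends₁ (fun _ : Bool => s(u, v))) a b c).card ≤
      (univ.filter fun ω₁ : ι₁ → Bool =>
        Sum.elim ω₁ id ∈ rSet (Sum.elim ends₁ (fun _ : Bool => s(u, v))) a b c).card) :
    (lSet (Sum.elim ends₁ ends₂) a b c).card ≤ (rSet (Sum.elim ends₁ ends₂) a b c).card := by
  classical
  rw [card_eq_sum_card_fibre (lSet (Sum.elim ends₁ ends₂) a b c),
    card_eq_sum_card_fibre (rSet (Sum.elim ends₁ ends₂) a b c)]
  exact sum_le_sum_of_pair fun ω₂ => fibre_pair_le hsep ha hb hc h0 h1 h2 ω₂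

end Count

end AntipodalR1

end Summit.CriticalPhenomena.PercolationContinuityZ3.Theorems
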